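import Summits.AtomisticToContinuum.Crystallization.Theorems.RadialDefectsVanish.Negative.FalseWithoutGS
import Literature.MathematicalPhysics.StatisticalMechanics.LennardJonesClusters

/-!
# Crux `GappedShellCensus.RadialDefectsVanish` (stmt-AtomisticToContinuum-15930) — negative lemmas, gen 2:
# scale exclusivity, the SCALE LOCK, and the refuted strengthening "every scale of the window works"

Kernel-checked findings of the crux disprover (cdisprove gen 2; the full dossier with verdict and
near-misses is `Cruxes/RadialDefectsVanish/Disproof.lean`):

* `not_isGappedTwelveAt_of_isGappedTwelveAt` — two scales `a < a'` with `1.02a < 0.98a'` and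
  `1.02a' < 1.26a` (e.g. the window's ends `47/50` and `1`) are EXCLUSIVE: no site is gapped-twelve at
  both; `le_card_bad_add_card_bad : N ≤ #bad_a + #bad_{a'}`.
* SCALE LOCK `scaleLock_of_eventually_small/large` — for ANY sequence, eventual `θ`-goodness at one
  scale forbids even frequent `θ'`-goodness at every exclusive scale (`θ + θ' < 1`).
* `not_radialDefectsVanishEveryScaleEventually` — the natural strengthening of the crux with
  `∀ a ∈ [47/50, 1]` (instead of `∃ a`) and `∀ᶠ N` (instead of `∃ᶠ N`) is FALSE: the `∃ a` is a genuine
  selection and a proof must produce the scale (`≈ a* = 0.9712`) from the energy.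
* SANITY `isGappedTwelveFin_fcc13` — the good predicate is satisfiable (centre of the fcc cluster at
  bond length `0.98995`, scale `1`), so the crux is not refutable for the trivial reason `#bad = N`.
-/

noncomputable section

open scoped Classical
open Filter
open Literature.MathematicalPhysics.StatisticalMechanics
open Summit.AtomisticToContinuum.Crystallization.Theses.GappedShellCensus

namespace Summit.AtomisticToContinuum.Crystallization.Theorems.RadialDefectsVanish.Negative

local notation "E3" => EuclideanSpace ℝ (Fin 3)

/-! ## §1 Two admissible scales are mutually exclusive at every site -/

variable {x : (N : ℕ) → (Fin N → E3)}

/-- **Scale exclusivity.** If `1.02·a < 0.98·a'` and `1.02·a' < 1.26·a` (e.g. `a = 47/50`, `a' = 1`: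
`0.9588 < 0.98`, `1.02 < 1.1844`), a site that is gapped-twelve at scale `a'` is NOT gapped-twelve at
scale `a`: it has a neighbour at distance `d ∈ [0.98a', 1.02a']`, and that `d` lies in the forbidden
annulus `(1.02a, 1.26a)` of scale `a`. [folklore] -/
theorem not_isGappedTwelveAt_of_isGappedTwelveAt {a a' : ℝ}
    (h1 : a * (1 + 1 / 50) < a' * (1 - 1 / 50)) (h2 : a' * (1 + 1 / 50) < a * (63 / 50))
    {N : ℕ} {i : Fin N} (h : IsGappedTwelveAt x a' N i) : ¬ IsGappedTwelveAt x a N i := by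
  rintro ⟨-, hfar⟩
  obtain ⟨hcard, hfar'⟩ := h
  have hne : (Finset.univ.filter fun j : Fin N =>
      j ≠ i ∧ dist (x N i) (x N j) ≤ a' * (1 + 1 / 50)).Nonempty := by
    rw [← Finset.card_pos, hcard]; norm_num
  obtain ⟨j, hj⟩ := hne
  simp only [Finset.mem_filter, Finset.mem_univ, true_and] at hj
  obtain ⟨hji, hd⟩ := hj
  obtain ⟨hlo, -⟩ := hfar' j hji
  obtain ⟨-, hor⟩ := hfar j hji
  rcases hor with h | h <;> linarith

/-- Hence at two exclusive scales the bad counts add up to at least `N`: every site is bad at `a`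
or bad at `a'`. [folklore] -/
theorem le_card_bad_add_card_bad {a a' : ℝ}
    (h1 : a * (1 + 1 / 50) < a' * (1 - 1 / 50)) (h2 : a' * (1 + 1 / 50) < a * (63 / 50)) (N : ℕ) :
    (N : ℝ) ≤ (Nat.card {i : Fin N // ¬ IsGappedTwelveAt x a N i} : ℝ) +
      (Nat.card {i : Fin N // ¬ IsGappedTwelveAt x a' N i} : ℝ) := by
  have key : ∀ i : Fin N, ¬ IsGappedTwelveAt x a N i ∨ ¬ IsGappedTwelveAt x a' N i := fun i => by
    by_cases h : IsGappedTwelveAt x a' N i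
    · exact Or.inl (not_isGappedTwelveAt_of_isGappedTwelveAt h1 h2 h)
    · exact Or.inr h
  have hN : N ≤ Nat.card {i : Fin N // ¬ IsGappedTwelveAt x a N i} +
      Nat.card {i : Fin N // ¬ IsGappedTwelveAt x a' N i} := by
    rw [Nat.card_eq_fintype_card, Nat.card_eq_fintype_card, Fintype.card_subtype,
      Fintype.card_subtype]
    calc N = (Finset.univ : Finset (Fin N)).card := by simp
      _ = (Finset.univ.filter fun i : Fin N =>
            ¬ IsGappedTwelveAt x a N i ∨ ¬ IsGappedTwelveAt x a' N i).card := by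
          rw [Finset.filter_true_of_mem fun i _ => key i]
      _ ≤ _ := by
          rw [Finset.filter_or]; exact Finset.card_union_le _ _
  exact_mod_cast hN

/-! ## §2 SCALE LOCK for the crux: eventual radial order at one scale forbids even frequent radial
order at every exclusive scale; the strengthening "every scale of the window works" is FALSE -/

/-- Abstract lock: if the bad counts at `b` and `b'` always add up to `≥ N`, then
`∀ᶠ N, #bad_b ≤ θN` and `∃ᶠ N, #bad_{b'} ≤ θ'N` are incompatible when `θ + θ' < 1`. [folklore] -/
theorem not_frequently_le_of_eventually_le {b b' θ θ' : ℝ}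
    (hcount : ∀ N : ℕ, (N : ℝ) ≤ (Nat.card {i : Fin N // ¬ IsGappedTwelveAt x b N i} : ℝ) +
      (Nat.card {i : Fin N // ¬ IsGappedTwelveAt x b' N i} : ℝ)) (hθ : θ + θ' < 1)
    (hev : ∀ᶠ N : ℕ in atTop, (Nat.card {i : Fin N // ¬ IsGappedTwelveAt x b N i} : ℝ) ≤ θ * N) :
    ¬ ∃ᶠ N : ℕ in atTop, (Nat.card {i : Fin N // ¬ IsGappedTwelveAt x b' N i} : ℝ) ≤ θ' * N := by
  intro hfr
  obtain ⟨N, ⟨hN1, hN2⟩, hN⟩ :=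
    ((hev.and_frequently hfr).and_eventually (eventually_ge_atTop 1)).exists
  have hNr : (1 : ℝ) ≤ N := by exact_mod_cast hN
  have hlt : θ * N + θ' * N < (N : ℝ) := by
    have := mul_lt_mul_of_pos_right hθ (by linarith : (0 : ℝ) < N)
    rwa [add_mul, one_mul] at this
  have := hcount N
  linarith

/-- **Scale lock (small scale eventually good).** For ANY sequence `x` (ground states or not): if
eventually all but `θN` sites are gapped-twelve at scale `a`, then at every exclusive larger scale
`a'` (`1.02a < 0.98a'`, `1.02a' < 1.26a`) it is not even FREQUENTLY true that all but `θ'N` sites are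
gapped-twelve, whenever `θ + θ' < 1`. [folklore] -/
theorem scaleLock_of_eventually_small {a a' θ θ' : ℝ}
    (h1 : a * (1 + 1 / 50) < a' * (1 - 1 / 50)) (h2 : a' * (1 + 1 / 50) < a * (63 / 50))
    (hθ : θ + θ' < 1)
    (hev : ∀ᶠ N : ℕ in atTop, (Nat.card {i : Fin N // ¬ IsGappedTwelveAt x a N i} : ℝ) ≤ θ * N) :
    ¬ ∃ᶠ N : ℕ in atTop, (Nat.card {i : Fin N // ¬ IsGappedTwelveAt x a' N i} : ℝ) ≤ θ' * N :=
  not_frequently_le_of_eventually_le (le_card_bad_add_card_bad h1 h2) hθ hev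

/-- **Scale lock (large scale eventually good)**, the mirror statement. [folklore] -/
theorem scaleLock_of_eventually_large {a a' θ θ' : ℝ}
    (h1 : a * (1 + 1 / 50) < a' * (1 - 1 / 50)) (h2 : a' * (1 + 1 / 50) < a * (63 / 50))
    (hθ : θ + θ' < 1)
    (hev : ∀ᶠ N : ℕ in atTop, (Nat.card {i : Fin N // ¬ IsGappedTwelveAt x a' N i} : ℝ) ≤ θ * N) :
    ¬ ∃ᶠ N : ℕ in atTop, (Nat.card {i : Fin N // ¬ IsGappedTwelveAt x a N i} : ℝ) ≤ θ' * N :=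
  not_frequently_le_of_eventually_le
    (fun N => by rw [add_comm]; exact le_card_bad_add_card_bad h1 h2 N) hθ hev

/-- NATURAL STRENGTHENING 1 — "every scale of the window works, eventually":
`RadialDefectsVanish` with `∃ a ∈ [47/50, 1]` replaced by `∀ a ∈ [47/50, 1]` and `∃ᶠ N` by `∀ᶠ N`. -/
def RadialDefectsVanishEveryScaleEventually : Prop :=
  ∀ x : (N : ℕ) → (Fin N → E3), (∀ N, IsGroundState lennardJones (x N)) →
    ∀ a : ℝ, 47 / 50 ≤ a → a ≤ 1 → ∀ θ : ℝ, 0 < θ → ∀ᶠ N : ℕ in atTop,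
      (Nat.card {i : Fin N // ¬ IsGappedTwelveAt x a N i} : ℝ) ≤ θ * N

/-- **Strengthening 1 is FALSE**: the two ends `a = 47/50` and `a' = 1` of the window are exclusive
scales, so along the (existing, `LennardJonesGroundStatesExist_holds`) sequence of ground states they
cannot both be eventually `1/3`-good.  Moral for provers: the `∃ a` of the crux is a genuine
selection (the set of scales at which a given sequence is eventually `θ`-good for all `θ` has
multiplicative width `≤ 1.02²/0.98² ≈ 1.083` and cannot contain two exclusive scales); any proof
must produce the scale — physically `a* ≈ 0.9712`, the relaxed close-packed bond length — from the
energy, it cannot be read off the window. [folklore] -/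
theorem not_radialDefectsVanishEveryScaleEventually : ¬ RadialDefectsVanishEveryScaleEventually := by
  intro h
  choose x hx using LennardJonesGroundStatesExist_holds
  have hsmall := h x hx (47 / 50) le_rfl (by norm_num) (1 / 3) (by norm_num)
  have hlarge := h x hx 1 (by norm_num) le_rfl (1 / 3) (by norm_num)
  exact scaleLock_of_eventually_small (x := x) (by norm_num) (by norm_num) (by norm_num) hsmall
    hlarge.frequently

/-! ## §4 Sanity: the GOOD predicate is satisfiable (the crux is not false for a trivial reason) -/

/-- Integer coordinate table (unit `1/10`): centre and the twelve fcc shell vectors `(±7, ±7, 0)` and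
permutations (bond length `7√2/10 = 0.98995 ∈ [0.98, 1.02]`). -/
def tab : Fin 13 → Fin 3 → ℤ :=
  ![![0, 0, 0], ![7, 7, 0], ![7, -7, 0], ![-7, 7, 0], ![-7, -7, 0], ![7, 0, 7], ![7, 0, -7],
    ![-7, 0, 7], ![-7, 0, -7], ![0, 7, 7], ![0, 7, -7], ![0, -7, 7], ![0, -7, -7]]

/-- Squared distances of the table, in units `1/100`. -/
def sqd (i j : Fin 13) : ℤ := ∑ k : Fin 3, (tab i k - tab j k) ^ 2

/-- The twelve shell points are at squared distance exactly `98` from the centre. [folklore] -/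
theorem sqd_shell : ∀ j : Fin 13, j ≠ 0 → sqd 0 j = 98 := by decide

/-- The fcc cluster: centre plus first coordination shell at bond length `0.98995`. -/
def fcc13 (i : Fin 13) : E3 := WithLp.toLp 2 fun k => ((tab i k : ℝ)) / 10

/-- Squared distances of `fcc13` from the integer table. [folklore] -/
theorem dist_sq_fcc13 (i j : Fin 13) : dist (fcc13 i) (fcc13 j) ^ 2 = (sqd i j : ℝ) / 100 := by
  rw [EuclideanSpace.dist_eq, Real.sq_sqrt (Finset.sum_nonneg fun _ _ => sq_nonneg _)]
  simp only [fcc13, PiLp.toLp_apply, Real.dist_eq, sq_abs, sqd]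
  push_cast
  rw [Finset.sum_div]
  exact Finset.sum_congr rfl fun k _ => by ring

/-- Shell distances of `fcc13` lie in `[0.98, 1.02]` (indeed `dist² = 0.98`). [folklore] -/
theorem shell_fcc13 {j : Fin 13} (h : j ≠ 0) :
    1 * (1 - 1 / 50) ≤ dist (fcc13 0) (fcc13 j) ∧ dist (fcc13 0) (fcc13 j) ≤ 1 * (1 + 1 / 50) := by
  have hsq : dist (fcc13 0) (fcc13 j) ^ 2 = 98 / 100 := by
    rw [dist_sq_fcc13, sqd_shell j h]; norm_num
  have hd : 0 ≤ dist (fcc13 0) (fcc13 j) := dist_nonneg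
  constructor <;> nlinarith

/-- Single-configuration reading of `IsGappedTwelveAt` (which takes a whole sequence):
`IsGappedTwelveAt X a N i = IsGappedTwelveFin a (X N) i` by `rfl`. -/
def IsGappedTwelveFin (a : ℝ) {N : ℕ} (y : Fin N → E3) (i : Fin N) : Prop :=
  (Finset.univ.filter fun j : Fin N => j ≠ i ∧ dist (y i) (y j) ≤ a * (1 + 1 / 50)).card = 12 ∧
    ∀ j : Fin N, j ≠ i → a * (1 - 1 / 50) ≤ dist (y i) (y j) ∧
      (dist (y i) (y j) ≤ a * (1 + 1 / 50) ∨ a * (63 / 50) ≤ dist (y i) (y j))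

/-- Read-back: the sequence predicate at `N` is the single-configuration predicate. [folklore] -/
theorem isGappedTwelveAt_eq (X : (N : ℕ) → (Fin N → E3)) (a : ℝ) (N : ℕ) (i : Fin N) :
    IsGappedTwelveAt X a N i = IsGappedTwelveFin a (X N) i := rfl

/-- **The good predicate is satisfiable**: the centre of `fcc13` is gapped-twelve at scale `a = 1`
(twelve neighbours at `0.98995 ∈ [0.98, 1.02]`, nothing else).  So `#bad = N` is NOT forced by the
shape of the predicate, and the crux is not refutable for a trivial reason. [folklore] -/
theorem isGappedTwelveFin_fcc13 : IsGappedTwelveFin 1 fcc13 0 := by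
  refine ⟨?_, fun j hj => ⟨(shell_fcc13 hj).1, Or.inl (shell_fcc13 hj).2⟩⟩
  have hset : (Finset.univ.filter fun j : Fin 13 => j ≠ 0 ∧ dist (fcc13 0) (fcc13 j) ≤ 1 * (1 + 1 / 50))
      = Finset.univ.filter fun j : Fin 13 => j ≠ 0 := by
    refine Finset.filter_congr fun j _ => ⟨fun h => h.1, fun h => ⟨h, (shell_fcc13 h).2⟩⟩
  rw [hset]
  decide

end Summit.AtomisticToContinuum.Crystallization.Theorems.RadialDefectsVanish.Negative

end
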